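import Mathlib
import Literature.LinearAlgebra.Matrix.PermanentLaplace

/-!
# Stub `stub_perProductBound` (crux `OrbitDimensionBound`, line `Sketch`)

The multilinear heart of the bound "a linear subspace of `M_n(ℂ)` on which `per_n` vanishes has
dimension `≤ n² - n`", in the product case: if row subspaces `K_0, …, K_{n-1} ≤ ℂⁿ` are such that
EVERY matrix whose `i`-th row lies in `K_i` (all `i`) has permanent zero, then
`Σ_i dim K_i ≤ n² - n` (stated additively, `Σ_i dim K_i + n ≤ n · n`).

Proof (induction on `n`).  For `n = m + 1`: if every `dim K_i ≤ m` we are done.  Otherwise some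
`K_{i₀} = ℂⁿ`.  If moreover every coordinate vector `e_j` lies in every `K_i`, the identity
matrix has its rows in the `K_i` and permanent `1 ≠ 0`, absurd.  So some `e_j ∉ K_{i₁}` with
`i₁ ≠ i₀`.  Put the row `e_j` in position `i₀`: the Laplace expansion along row `i₀`
(`Matrix.permanent_eq_sum_row`) shows that `per_m` vanishes on all `m × m` matrices whose rows
lie in the projections `π_j K_i` (`i ≠ i₀`, `π_j` = delete coordinate `j`), so by induction
`Σ_{i ≠ i₀} dim π_j K_i + m ≤ m²`.  Finally `dim K_i ≤ dim π_j K_i + 1` always (the kernel of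
`π_j` is the line `ℂ e_j`), with `dim K_{i₁} ≤ dim π_j K_{i₁}` because `e_j ∉ K_{i₁}`; hence
`Σ_{i ≠ i₀} dim K_i + 1 ≤ m²` and `Σ_i dim K_i + n = (m + 1) + Σ_{i ≠ i₀} dim K_i + (m + 1)
≤ (m + 1)²`.

Only Mathlib and the tree's Laplace expansion of the permanent
(`Literature/LinearAlgebra/Matrix/PermanentLaplace.lean`) are used.
-/

set_option linter.dupNamespace false

namespace Summit.ValiantsHypothesis.ValiantsHypothesis.Theorems.FreeSubtorusOrbitDimensionBound

open Finset Module

/-- Rank–nullity in submodule form: for a linear map `f` and a subspace `K` of a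
finite-dimensional space, `dim f(K) + dim (K ⊓ ker f) = dim K`. [folklore] -/
theorem finrank_map_add_finrank_inf_ker {V W : Type*} [AddCommGroup V] [Module ℂ V]
    [AddCommGroup W] [Module ℂ W] [FiniteDimensional ℂ V] (f : V →ₗ[ℂ] W) (K : Submodule ℂ V) :
    finrank ℂ (K.map f) + finrank ℂ (K ⊓ LinearMap.ker f : Submodule ℂ V) = finrank ℂ K := by
  rw [← LinearMap.range_domRestrict, ← Submodule.map_comap_subtype, Submodule.finrank_map_subtype_eq,
    ← LinearMap.ker_domRestrict]
  exact LinearMap.finrank_range_add_finrank_ker _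

/-- The kernel of the coordinate-deleting projection `π_j : v ↦ v ∘ j.succAbove` is contained in
the line spanned by the coordinate vector `e_j`. [folklore] -/
theorem ker_funLeft_succAbove_le {m : ℕ} (j : Fin (m + 1)) :
    LinearMap.ker (LinearMap.funLeft ℂ ℂ (Fin.succAbove j)) ≤
      ℂ ∙ (Pi.single j (1 : ℂ) : Fin (m + 1) → ℂ) := by
  intro v hv
  rw [LinearMap.mem_ker] at hv
  rw [Submodule.mem_span_singleton]
  refine ⟨v j, ?_⟩
  funext k
  rcases Fin.eq_self_or_eq_succAbove j k with rfl | ⟨k', rfl⟩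
  · simp
  · have hk : v (j.succAbove k') = 0 := by
      have := congrFun hv k'
      simpa only [LinearMap.funLeft_apply, Pi.zero_apply] using this
    simp [hk, Fin.succAbove_ne]

/-- Deleting one coordinate loses at most one dimension:
`dim K ≤ dim π_j(K) + 1` for every subspace `K ≤ ℂ^{m+1}`. [folklore] -/
theorem finrank_le_finrank_map_funLeft_succ {m : ℕ} (j : Fin (m + 1))
    (K : Submodule ℂ (Fin (m + 1) → ℂ)) :
    finrank ℂ K ≤ finrank ℂ (K.map (LinearMap.funLeft ℂ ℂ (Fin.succAbove j))) + 1 := by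
  rw [← finrank_map_add_finrank_inf_ker (LinearMap.funLeft ℂ ℂ (Fin.succAbove j)) K]
  gcongr
  calc finrank ℂ ↥(K ⊓ LinearMap.ker (LinearMap.funLeft ℂ ℂ (Fin.succAbove j)))
      ≤ finrank ℂ (ℂ ∙ (Pi.single j (1 : ℂ) : Fin (m + 1) → ℂ)) :=
        Submodule.finrank_mono (inf_le_right.trans (ker_funLeft_succAbove_le j))
    _ = 1 := finrank_span_singleton (by simp)

/-- If the coordinate vector `e_j` does not lie in `K ≤ ℂ^{m+1}`, deleting the coordinate `j` is
injective on `K`, so `dim K ≤ dim π_j(K)`. [folklore] -/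
theorem finrank_le_finrank_map_funLeft_of_notMem {m : ℕ} (j : Fin (m + 1))
    (K : Submodule ℂ (Fin (m + 1) → ℂ)) (hj : (Pi.single j (1 : ℂ) : Fin (m + 1) → ℂ) ∉ K) :
    finrank ℂ K ≤ finrank ℂ (K.map (LinearMap.funLeft ℂ ℂ (Fin.succAbove j))) := by
  rw [← finrank_map_add_finrank_inf_ker (LinearMap.funLeft ℂ ℂ (Fin.succAbove j)) K]
  suffices h : K ⊓ LinearMap.ker (LinearMap.funLeft ℂ ℂ (Fin.succAbove j)) = ⊥ by
    rw [h, finrank_bot, add_zero]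
  rw [eq_bot_iff]
  rintro v ⟨hvK, hv⟩
  obtain ⟨c, hc⟩ := Submodule.mem_span_singleton.1 (ker_funLeft_succAbove_le j hv)
  by_cases hc0 : c = 0
  · rw [Submodule.mem_bot, ← hc, hc0, zero_smul]
  · exfalso
    apply hj
    have : (Pi.single j (1 : ℂ) : Fin (m + 1) → ℂ) = c⁻¹ • v := by
      rw [← hc, smul_smul, inv_mul_cancel₀ hc0, one_smul]
    rw [this]
    exact K.smul_mem _ hvK

/-- Hypothesis transfer through the Laplace expansion.  If every matrix with row `i` in `K i`
(all `i`) has permanent zero and `K i₀ = ℂ^{m+1}`, then every `m × m` matrix whose row `i'` lies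
in the projection `π_j (K (i₀.succAbove i'))` has permanent zero: lift the rows, insert the row
`e_j` in position `i₀`, and expand along that row (`Matrix.permanent_eq_sum_row`). [folklore] -/
theorem permanent_eq_zero_of_rows_mem_map {m : ℕ} (K : Fin (m + 1) → Submodule ℂ (Fin (m + 1) → ℂ))
    (hK : ∀ X : Fin (m + 1) → Fin (m + 1) → ℂ, (∀ i, X i ∈ K i) → (Matrix.of X).permanent = 0)
    (i₀ : Fin (m + 1)) (hi₀ : K i₀ = ⊤) (j : Fin (m + 1)) (Y : Fin m → Fin m → ℂ)
    (hY : ∀ i', Y i' ∈ (K (i₀.succAbove i')).map (LinearMap.funLeft ℂ ℂ (Fin.succAbove j))) :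
    (Matrix.of Y).permanent = 0 := by
  classical
  choose v hvK hvY using fun i' => Submodule.mem_map.1 (hY i')
  let A : Fin (m + 1) → Fin (m + 1) → ℂ := Fin.insertNth i₀ (Pi.single j 1) v
  have hA : ∀ i, A i ∈ K i := by
    intro i
    rcases Fin.eq_self_or_eq_succAbove i₀ i with rfl | ⟨i', rfl⟩
    · simp [A, hi₀]
    · simp [A, hvK]
  have hsub : (Matrix.of A).submatrix (Fin.succAbove i₀) (Fin.succAbove j) = Matrix.of Y := by
    ext i' k
    have := congrFun (hvY i') k
    simp only [LinearMap.funLeft_apply] at this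
    simp [A, this]
  calc (Matrix.of Y).permanent
      = ∑ j', (Matrix.of A) i₀ j' *
          ((Matrix.of A).submatrix (Fin.succAbove i₀) (Fin.succAbove j')).permanent := by
        rw [Finset.sum_eq_single j]
        · rw [hsub]
          simp [A]
        · intro j' _ hj'
          simp [A, hj']
        · simp
    _ = (Matrix.of A).permanent := (Matrix.permanent_eq_sum_row _ i₀).symm
    _ = 0 := hK A hA

/-- **Registered stub `stub_perProductBound`** (the multilinear heart).  If row subspaces
`K_0, …, K_{n-1} ≤ ℂⁿ` have the property that EVERY matrix with row `i` in `K_i` (all `i`) has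
permanent zero, then `Σ_i dim K_i + n ≤ n²`.  Induction on `n`: either every `dim K_i ≤ n - 1`,
or some `K_{i₀} = ℂⁿ`; if all coordinate vectors lie in all `K_i` the identity matrix has
permanent `1 ≠ 0`; otherwise some `e_j ∉ K_{i₁}` (`i₁ ≠ i₀`), the Laplace expansion along the
row `i₀ = e_j` transfers the hypothesis to the projections `π_j K_i` (`i ≠ i₀`) in dimension
`n - 1`, and `dim K_i ≤ dim π_j K_i + 1` (with `≤ dim π_j K_{i₁}` at `i₁`) closes the count.
[folklore] -/
theorem stub_perProductBound :
    ∀ (n : ℕ) (K : Fin n → Submodule ℂ (Fin n → ℂ)),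
      (∀ X : Fin n → Fin n → ℂ, (∀ i, X i ∈ K i) → (Matrix.of X).permanent = 0) →
      ∑ i, Module.finrank ℂ (K i) + n ≤ n * n := by
  intro n
  induction n with
  | zero =>
    intro K hK
    simp
  | succ m ih =>
    intro K hK
    classical
    -- Case 1: every row space has dimension `≤ m`.
    by_cases hsmall : ∀ i, finrank ℂ (K i) ≤ m
    · calc ∑ i, finrank ℂ (K i) + (m + 1) ≤ ∑ _i : Fin (m + 1), m + (m + 1) := by
            gcongr with i
            exact hsmall i
        _ = (m + 1) * (m + 1) := by simp; ring
    push Not at hsmall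
    obtain ⟨i₀, hi₀⟩ := hsmall
    have htop : K i₀ = ⊤ := by
      apply Submodule.eq_top_of_finrank_eq
      apply le_antisymm (Submodule.finrank_le _)
      rw [Module.finrank_fin_fun]
      omega
    -- Case 2: all coordinate vectors lie in all row spaces: the identity matrix contradicts.
    by_cases hall : ∀ i j : Fin (m + 1), (Pi.single j (1 : ℂ) : Fin (m + 1) → ℂ) ∈ K i
    · exfalso
      have h1 := hK (fun i j => (1 : Matrix (Fin (m + 1)) (Fin (m + 1)) ℂ) i j) (fun i => by
        have : (fun j => (1 : Matrix (Fin (m + 1)) (Fin (m + 1)) ℂ) i j) = Pi.single i 1 := by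
          funext j
          exact Matrix.one_eq_pi_single
        rw [this]
        exact hall i i)
      have h2 : (Matrix.of fun i j => (1 : Matrix (Fin (m + 1)) (Fin (m + 1)) ℂ) i j).permanent = 1 :=
        Matrix.permanent_one
      exact one_ne_zero (h2.symm.trans h1)
    -- Case 3: some `e_j ∉ K i₁`, necessarily with `i₁ ≠ i₀`.
    push Not at hall
    obtain ⟨i₁, j, hij⟩ := hall
    have hne : i₁ ≠ i₀ := by
      rintro rfl
      rw [htop] at hij
      exact hij Submodule.mem_top
    obtain ⟨i₁', rfl⟩ := Fin.exists_succAbove_eq hne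
    -- induction hypothesis for the projected family
    have ih' := ih (fun i' => (K (i₀.succAbove i')).map (LinearMap.funLeft ℂ ℂ (Fin.succAbove j)))
      (fun Y hY => permanent_eq_zero_of_rows_mem_map K hK i₀ htop j Y hY)
    have hlt : ∑ i', finrank ℂ (K (i₀.succAbove i')) <
        ∑ i', (finrank ℂ ((K (i₀.succAbove i')).map (LinearMap.funLeft ℂ ℂ (Fin.succAbove j))) + 1) :=
      Finset.sum_lt_sum (fun i' _ => finrank_le_finrank_map_funLeft_succ j _)
        ⟨i₁', Finset.mem_univ _,
          Nat.lt_succ_of_le (finrank_le_finrank_map_funLeft_of_notMem j _ hij)⟩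
    rw [Finset.sum_add_distrib, Finset.sum_const, Finset.card_univ, Fintype.card_fin, smul_eq_mul,
      mul_one] at hlt
    rw [Fin.sum_univ_succAbove _ i₀, htop, finrank_top, Module.finrank_fin_fun]
    nlinarith [hlt, ih']

end Summit.ValiantsHypothesis.ValiantsHypothesis.Theorems.FreeSubtorusOrbitDimensionBound
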